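/-
Copyright (c) 2026. All rights reserved.
Released under Apache 2.0 license as described in the file LICENSE.
Authors: HodgeCM-Mathlib publication cell (pub/hodgecm-mathlib), floor-0 programme P4, seat F0P4-p06 (S4a lead).
-/
import Literature.NumberTheory.GelbartRogawski1991.LocalLineIsometryWeilIntertwiner
import Literature.NumberTheory.GelbartRogawski1991.UnitaryDualPairChiLineFinRepLocal
import Literature.NumberTheory.GelbartRogawski1991.FiniteAdelicSplittingFinRep
import Literature.NumberTheory.Automorphic.Liu2021.Def411WeilCarriersAtLineTwoLinesTransportV
import Literature.NumberTheory.Automorphic.RestrictedTensorProductLocalTransport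
import Literature.NumberTheory.Automorphic.RestrictedTensorProductCentralCoinvariants
import Literature.NumberTheory.Automorphic.UnitaryGroupDualPairLocalLine
import Literature.NumberTheory.Automorphic.QuadraticLocalNormWitnessFamily
import HarnessLib

/-!
# [Liu2021, Def. 4.11]: `ω(μ, ε, χ)` at a line depends only on the finite local norm classes of the line — the line-class
# transport ASSEMBLED, modulo the unramified-vector clause

Topic `NumberTheory/Automorphic/Liu2021`; namespaces `Literature.NumberTheory.GelbartRogawski1991.UnitaryDualPair.LocalSplitting.FinLocalSplittings`
(§1, generic) and `Literature.NumberTheory.Automorphic.Liu2021.Def411WeilCarriers` (§2).  THEOREMS ONLY; nothing of [Liu2021] is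
asserted.  Cell hodgecm-mathlib, crux H413 (stmt-HodgeConjecture-24833), stub S4a `StubT3aLineTransportAt` ∕ the MASTER
`lineClassTransport_equiv` (also P2's (C′) `rhoAtLine_lineClassTransport` and the S5 closer): this file is the ASSEMBLY of road (F).

ROAD (F) ([Flath1979, §2 Example 2] «local isomorphisms with compatible base vectors glue»):
* §1 (generic, any dual pair `U(J_V) × U(J_W)`, `J_W` a line, any family `𝓢` of local splittings of the big group): the
  `U(J_V)(𝔸_{F,f})`-representation `k ↦ Ω_𝓢(reindex (k ⊗ 1))` read on `Πʳ_v [U(J_V)(F_v), U(J_V)(𝒪_v)]` IS `⊗'_v (ω_{𝓢,v} ∘ (k ↦ k ⊗ 1))`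
  (`isRestrictedTensorProductRep_omegaPi_comp_localLineInl`: ★ `isRestrictedTensorProductRep_finiteAdeleRep` ∘ ★
  `IsRestrictedTensorProductRep.comp` along ★ `localLineInl`), and `Ω_𝓢(reindex (k ⊗ 1)) = (⊗'_v …)(finAdelicEquiv k)`
  (`Omega_finPairEmb_inl`, ★ `finAdelicEquiv_finPairEmb_inl_eq_mapAlong`);
* §2 (CM, frame `e₁ = Equiv.prodUnique (Fin N) (Fin 1)`): for lines `a₁, a₂ ∈ (L⁺)ˣ` with `locF a₁ = locF a₂` — the same norm class at every
  finite place — ★ `exists_localRing_units_lineDelta_eq` gives local isometry witnesses `x_v` (integral a.e.), ★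
  `lineTransportOp_omegaLoc_localLineInl` (`LocalLineIsometryWeilIntertwiner`) makes `M_{x_v}` a `U(diag dV)(F_v)`-isomorphism of the
  local Weil representations at the two `θ`-lines, and — GIVEN the unramified-vector clause `hP3` («`M_{x_v} 𝟙_{𝒪_vᴺ} ∈ ℂˣ 𝟙_{𝒪_vᴺ}` for
  almost all `v`», the cell's item (P′3)∕(C2), stated here as a HYPOTHESIS) — ★ `IsRestrictedTensorProductRep.exists_equiv_of_forall_equiv`
  glues them to `E : 𝒮((𝔸_F^∞)ᴺ) ≃ₗ 𝒮((𝔸_F^∞)ᴺ)` intertwining the two `Ω(reindex (k ⊗ 1))`; conjugating by the Kronecker re-indexing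
  `R_{e₁}` and ★ `finPairRepV_chiSplittingLine_apply` gives the intertwiner of `finPairRepV[a₁]`, `finPairRepV[a₂]`, and ★ (T0′)
  `exists_omegaAtLine_equiv_rhoVAtLine_of_twoLines_V` descends it:
  **`exists_omegaAtLine_equiv_rhoVAtLine_of_locF_eq_of_unramifiedVector`** —
  `∃ Ψ : omegaAtLine … a₁ χ ≃ₗ[ℂ] omegaAtLine … a₂ χ, ∀ k x, Ψ (rhoVAtLine … a₁ χ k x) = rhoVAtLine … a₂ χ k (Ψ x)`.

So the registered letter S4a is CLOSED MODULO (P′3) at the pin's frame; the frame-general form follows by the `e`-reindex brick.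
HC_CM is proved only modulo the printed citations until rung 0 closes; this file proves nothing printed.

## References
* [Liu2021] Y. Liu, Camb. J. Math. 9 (2021) = arXiv:2102.11518: Def. 4.11 (l. 2092–2096), Def. 4.12, App. D §D.1 Step 1 footnote
  (l. 5215), Lemma D.1 (3) (l. 5233).
* [Flath1979] D. Flath, PSPM 33 (1979) part 1, §2 Example 2 and the Remark following it.
* [MoeglinVignerasWaldspurger1987] C. Mœglin, M.-F. Vignéras, J.-L. Waldspurger, LNM 1291 (1987), Chap. 2 II.1, Chap. 3 I.1–I.3.
* [GelbartRogawski1991] S. Gelbart, J. Rogawski, Invent. Math. 105 (1991), §3.1 Prop. 3.1.1, Remark p. 457 L4–13.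
-/

set_option autoImplicit false

noncomputable section

open scoped Matrix Kronecker RestrictedProduct
open Filter Function Set NumberField IsDedekindDomain
open Literature.RepresentationTheory.HeisenbergGroup
open Literature.NumberTheory.Automorphic Literature.NumberTheory.Automorphic.UnitaryGroup
open Literature.NumberTheory.Weil1964 Literature.RepresentationTheory

/-! ## §1 `k ↦ Ω_𝓢(reindex (k ⊗ 1))` is `⊗'_v (ω_{𝓢,v} ∘ (k ↦ k ⊗ 1))` -/

namespace Literature.NumberTheory.GelbartRogawski1991.UnitaryDualPair.LocalSplitting.FinLocalSplittings

variable {F : Type} [Field F] [NumberField F] {E : Type} [Field E] [NumberField E] [Algebra F E]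
  [Algebra.IsQuadraticExtension F E] {c : E ≃ₐ[F] E} {N n : ℕ} (e : Fin N × Fin 1 ≃ Fin n) {δ : E} {hcδ : c δ = -δ} {hδ : δ ≠ 0}
  {d : F} {hd : δ * δ = algebraMap F E d} (JV : Matrix (Fin N) (Fin N) E) (JW : Matrix (Fin 1) (Fin 1) E)
  {T : Matrix (Fin n) (Fin n) F} {hT : T.IsSymm} {hJ : Matrix.reindex e e (JV ⊗ₖ JW) = T.map (algebraMap F E)}
  (𝓢 : FinLocalSplittings F E c n hcδ hδ hd T hT hJ)

open scoped Classical in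
/-- **`Ω_𝓢` restricted along `k ↦ reindex (k ⊗ 1)`, read on `Πʳ_v [U(J_V)(F_v), U(J_V)(𝒪_v)]`, IS `⊗'_v (ω_{𝓢,v} ∘ localLineInl v)`**
(exceptional set `∅`): ★ `isRestrictedTensorProductRep_finiteAdeleRep` restricted along the local embeddings ★ `localLineInl`
(★ `IsRestrictedTensorProductRep.comp`, ★ `eventually_localLineInl_mapsTo_localInt`). [cite: Flath1979, §2 Example 2]
[cite: GelbartRogawski1991, §3.2 p. 457] -/
theorem isRestrictedTensorProductRep_omegaPi_comp_localLineInl :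
    IsRestrictedTensorProductRep (K := fun v => localInt E c N JV v)
      (fun v => show Representation ℂ (localPi E c N JV v) _ from (𝓢.omegaLoc v).comp (localLineInl E c N e JV JW v))
      (𝓢.OmegaPi.comp (RestrictedProduct.mapAlongMonoidHom (fun v => localPi E c N JV v)
        (fun v => localPi E c n (Matrix.reindex e e (JV ⊗ₖ JW)) v) id Filter.tendsto_id
        (fun v => localLineInl E c N e JV JW v) (eventually_localLineInl_mapsTo_localInt E c N e JV JW)))
      (Representation.eventually_mem_fixedPoints_comp (fun v => localLineInl E c N e JV JW v) 𝓢.unitVec_mem_fixedPoints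
        (eventually_localLineInl_mapsTo_localInt E c N e JV JW))
      (piProdSB F (Fin n)) ∅ :=
  (isRestrictedTensorProductRep_finiteAdeleRep F (Fin n) 𝓢.omegaLoc 𝓢.unitVec_mem_fixedPoints).comp _ _

/-- `Ω_𝓢(reindex (k ⊗ 1)) = (⊗'_v ω_{𝓢,v} ∘ Πʳ localLineInl) (finAdelicEquiv k)` (★ `finAdelicEquiv_finPairEmb_inl_eq_mapAlong`).
[cite: GelbartRogawski1991, §3.2 p. 457] -/
theorem Omega_finPairEmb_inl (k : finAdelic F E c N JV) :
    𝓢.Omega (finPairEmb F E c N 1 e JV JW (k, 1)) =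
      (𝓢.OmegaPi.comp (RestrictedProduct.mapAlongMonoidHom (fun v => localPi E c N JV v)
        (fun v => localPi E c n (Matrix.reindex e e (JV ⊗ₖ JW)) v) id Filter.tendsto_id
        (fun v => localLineInl E c N e JV JW v) (eventually_localLineInl_mapsTo_localInt E c N e JV JW)))
        (finAdelicEquiv F E c N JV k) := by
  exact congrArg 𝓢.OmegaPi (finAdelicEquiv_finPairEmb_inl_eq_mapAlong E c N e JV JW k)

end Literature.NumberTheory.GelbartRogawski1991.UnitaryDualPair.LocalSplitting.FinLocalSplittings

/-! ## §2 The line-class transport assembled (CM, frame `Equiv.prodUnique`), modulo the unramified-vector clause -/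

namespace Literature.NumberTheory.Automorphic.Liu2021.Def411WeilCarriers

open Literature.NumberTheory.GelbartRogawski1991 Literature.NumberTheory.GelbartRogawski1991.UnitaryDualPair
open Literature.NumberTheory.GelbartRogawski1991.UnitaryDualPair.WeilCoinv
open Literature.NumberTheory.GelbartRogawski1991.UnitaryDualPair.LocalSplitting
open Literature.NumberTheory.GelbartRogawski1991.GRConstruction (Fp congrW undoubledSplittings cmFinLocalFamily borelPlaceMeasure)
open Literature.NumberTheory.Automorphic.Liu2021.Def411WeilCarriersDoubling (lineW complexConj_lineW lineW_ne_zero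
  realDiagonal_lineW diagonal_lineW chiSplittingLine isCompatible_chiSplittingLine)
open Literature.NumberTheory.GaloisRepresentations Literature.RepresentationTheory.HarrisKudlaSweet1996

variable (L : Type) [Field L] [NumberField L] [IsCMField L] {N : ℕ} (hN : 0 < N)
  (dV : Fin N → L) (hdV : ∀ i, IsCMField.complexConj L (dV i) = dV i) (hdV0 : ∀ i, dV i ≠ 0)
  (θ : HeckeCharacter L) (hθu : θ.IsUnitary) (hθs : IsSplittingChar L 1 θ)
  (χ : Chi (Fp L) L (IsCMField.complexConj L)) (a₁ a₂ : (Fp L)ˣ)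

-- heartbeats: the statement displays the unramified-vector clause over the two CM local families of record and the
-- line-transport operators (the telescopes of ★ S6a, whose statement alone needs 1 600 000); default 200 000 times out.
set_option maxHeartbeats 3200000 in
include hN in
/-- **[Liu2021, App. D §D.1 Step 1 footnote l. 5215] at the frame `Equiv.prodUnique`, MODULO the unramified-vector clause (P′3):**
for lines `a₁, a₂ ∈ (L⁺)ˣ` with the same local norm class at every finite place (`locF L⁺ δ² a₁ = locF L⁺ δ² a₂`), GIVEN that the local
line-transport operators `M_{x_v}` at any family of witnesses `x_v` (`a₂⁻¹δ = x_v x̄_v a₁⁻¹δ`, integral a.e.) fix the unramified vector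
`𝟙_{𝒪_vᴺ}` up to a unit for almost all `v` (`hP3`), the carriers `ω(μ, ε, χ)` at the `θ`-attached splittings of the lines `⟨a₁⟩`, `⟨a₂⟩` are
ISOMORPHIC, `U(diag dV)(𝔸_{L⁺,f})`-equivariantly on the nose: `∃ Ψ, ∀ k x, Ψ (rhoVAtLine … a₁ χ k x) = rhoVAtLine … a₂ χ k (Ψ x)`.
Road (F): local witnesses ★ `exists_localRing_units_lineDelta_eq`; local equivalences ★ `lineTransportOp_omegaLoc_localLineInl`; gluing
★ `IsRestrictedTensorProductRep.exists_equiv_of_forall_equiv` over `⊗'_v (ω_{a,v} ∘ (k ↦ k ⊗ 1))` (§1); Kronecker re-indexing ★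
`finPairRepV_chiSplittingLine_apply`; descent ★ `exists_omegaAtLine_equiv_rhoVAtLine_of_twoLines_V`.
[cite: Liu2021, Def. 4.11 (l. 2092–2096); Def. 4.12; App. D §D.1 Step 1 footnote (l. 5215)] [cite: Flath1979, §2 Example 2]
[cite: MoeglinVignerasWaldspurger1987, Chap. 3 I.1–I.3] [cite: GelbartRogawski1991, §3.1 Remark p. 457 L4–13] -/
theorem exists_omegaAtLine_equiv_rhoVAtLine_of_locF_eq_of_unramifiedVector
    (hloc : locF (Fp L) (imagUnitSq L) a₁ = locF (Fp L) (imagUnitSq L) a₂)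
    (hP3 : ∀ (x : ∀ v : HeightOneSpectrum (𝓞 (Fp L)), (LocalRing L v)ˣ)
      (hx : ∀ v, algebraMap L (LocalRing L v) (algebraMap (Fp L) L (↑a₂⁻¹ : Fp L) * imagUnit L) =
        (x v : LocalRing L v) * conjLocal L (IsCMField.complexConj L) v (x v) *
          algebraMap L (LocalRing L v) (algebraMap (Fp L) L (↑a₁⁻¹ : Fp L) * imagUnit L)),
      (∀ᶠ v in cofinite, ∀ w : UnitaryGroup.PlacesOver L v, (x v : LocalRing L v) w ∈ w.1.adicCompletionIntegers L ∧
          (((x v)⁻¹ : (LocalRing L v)ˣ) : LocalRing L v) w ∈ w.1.adicCompletionIntegers L) →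
      ∀ᶠ v in cofinite, ∃ cv : ℂˣ, unitVec (Fp L) (Fin N) v =
        cv • (Literature.RepresentationTheory.MoeglinVignerasWaldspurger1987.lineTransportOp L v (IsCMField.complexConj L) N
          (conj_lineDelta (complexConj_imagUnit L) a₁) (lineDelta_ne_zero (imagUnit_ne_zero L) a₁)
          (lineDelta_mul_self (imagUnit_mul_self L) a₁) (conj_lineDelta (complexConj_imagUnit L) a₂)
          (lineDelta_ne_zero (imagUnit_ne_zero L) a₂) (lineDelta_mul_self (imagUnit_mul_self L) a₂) (x v)
          (realDiagonal L dV hdV) (realDiagonal_isSymm L dV hdV) (isUnit_det_realDiagonal L dV hdV hdV0) (hx v)) (unitVec (Fp L) (Fin N) v)) :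
    ∃ Ψ : omegaAtLine (Fp L) L (IsCMField.complexConj L) N (Equiv.prodUnique (Fin N) (Fin 1)) (Matrix.diagonal dV)
          (complexConj_imagUnit L) (imagUnit_ne_zero L) (imagUnit_mul_self L) (realDiagonal_isSymm L dV hdV)
          (isUnit_det_realDiagonal L dV hdV hdV0) (realDiagonal_map L dV hdV).symm
          (fun b => isCompatible_chiSplittingLine L (Equiv.prodUnique (Fin N) (Fin 1)) dV hdV hdV0 θ hθu hθs (TW (Fp L) b)
            (isSymm_TW (Fp L) b) (isUnit_det_TW (Fp L) b) (JW (Fp L) L b) (JW_eq (Fp L) L b)) a₁ χ ≃ₗ[ℂ]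
        omegaAtLine (Fp L) L (IsCMField.complexConj L) N (Equiv.prodUnique (Fin N) (Fin 1)) (Matrix.diagonal dV)
          (complexConj_imagUnit L) (imagUnit_ne_zero L) (imagUnit_mul_self L) (realDiagonal_isSymm L dV hdV)
          (isUnit_det_realDiagonal L dV hdV hdV0) (realDiagonal_map L dV hdV).symm
          (fun b => isCompatible_chiSplittingLine L (Equiv.prodUnique (Fin N) (Fin 1)) dV hdV hdV0 θ hθu hθs (TW (Fp L) b)
            (isSymm_TW (Fp L) b) (isUnit_det_TW (Fp L) b) (JW (Fp L) L b) (JW_eq (Fp L) L b)) a₂ χ,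
      ∀ (k : finAdelic (Fp L) L (IsCMField.complexConj L) N (Matrix.diagonal dV))
        (y : omegaAtLine (Fp L) L (IsCMField.complexConj L) N (Equiv.prodUnique (Fin N) (Fin 1)) (Matrix.diagonal dV)
          (complexConj_imagUnit L) (imagUnit_ne_zero L) (imagUnit_mul_self L) (realDiagonal_isSymm L dV hdV)
          (isUnit_det_realDiagonal L dV hdV hdV0) (realDiagonal_map L dV hdV).symm
          (fun b => isCompatible_chiSplittingLine L (Equiv.prodUnique (Fin N) (Fin 1)) dV hdV hdV0 θ hθu hθs (TW (Fp L) b)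
            (isSymm_TW (Fp L) b) (isUnit_det_TW (Fp L) b) (JW (Fp L) L b) (JW_eq (Fp L) L b)) a₁ χ),
        Ψ (rhoVAtLine (Fp L) L (IsCMField.complexConj L) N (Equiv.prodUnique (Fin N) (Fin 1)) (Matrix.diagonal dV)
            (complexConj_imagUnit L) (imagUnit_ne_zero L) (imagUnit_mul_self L) (realDiagonal_isSymm L dV hdV)
            (isUnit_det_realDiagonal L dV hdV hdV0) (realDiagonal_map L dV hdV).symm
            (fun b => isCompatible_chiSplittingLine L (Equiv.prodUnique (Fin N) (Fin 1)) dV hdV hdV0 θ hθu hθs (TW (Fp L) b)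
              (isSymm_TW (Fp L) b) (isUnit_det_TW (Fp L) b) (JW (Fp L) L b) (JW_eq (Fp L) L b)) a₁ χ k y) =
          rhoVAtLine (Fp L) L (IsCMField.complexConj L) N (Equiv.prodUnique (Fin N) (Fin 1)) (Matrix.diagonal dV)
            (complexConj_imagUnit L) (imagUnit_ne_zero L) (imagUnit_mul_self L) (realDiagonal_isSymm L dV hdV)
            (isUnit_det_realDiagonal L dV hdV hdV0) (realDiagonal_map L dV hdV).symm
            (fun b => isCompatible_chiSplittingLine L (Equiv.prodUnique (Fin N) (Fin 1)) dV hdV hdV0 θ hθu hθs (TW (Fp L) b)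
              (isSymm_TW (Fp L) b) (isUnit_det_TW (Fp L) b) (JW (Fp L) L b) (JW_eq (Fp L) L b)) a₂ χ k (Ψ y) := by
  classical
  -- local isometry witnesses from the equality of the local norm classes
  obtain ⟨x, hx, hint⟩ := exists_localRing_units_lineDelta_eq L (IsCMField.complexConj L) (complexConj_imagUnit L)
    (imagUnit_mul_self L) (imagUnit_ne_zero L) a₁ a₂ (fun v => congr_fun hloc v)
  -- the two `⊗'` certificates of `k ↦ Ω_{aᵢ}(reindex (k ⊗ 1))`
  have h₁ := FinLocalSplittings.isRestrictedTensorProductRep_omegaPi_comp_localLineInl (Equiv.prodUnique (Fin N) (Fin 1))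
    (Matrix.diagonal dV) (JW (Fp L) L a₁)
    (congrW L (Equiv.prodUnique (Fin N) (Fin 1)) dV hdV (lineW L (TW (Fp L) a₁)) (complexConj_lineW L (TW (Fp L) a₁))
            (realDiagonal_lineW L (TW (Fp L) a₁)) (diagonal_lineW L (TW (Fp L) a₁) (JW_eq (Fp L) L a₁))
            (undoubledSplittings L (Equiv.prodUnique (Fin N) (Fin 1)) dV hdV hdV0 (lineW L (TW (Fp L) a₁))
              (complexConj_lineW L (TW (Fp L) a₁)) (lineW_ne_zero L (TW (Fp L) a₁) (isUnit_det_TW (Fp L) a₁)) θ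
              (borelPlaceMeasure L)
              (cmFinLocalFamily L (Equiv.prodUnique (Fin N) (Fin 1)) dV hdV hdV0 (lineW L (TW (Fp L) a₁))
                (complexConj_lineW L (TW (Fp L) a₁)) (lineW_ne_zero L (TW (Fp L) a₁) (isUnit_det_TW (Fp L) a₁)) θ hθs
                (borelPlaceMeasure L)))
            (isSymm_TW (Fp L) a₁) (JW_eq (Fp L) L a₁))
  have h₂ := FinLocalSplittings.isRestrictedTensorProductRep_omegaPi_comp_localLineInl (Equiv.prodUnique (Fin N) (Fin 1))
    (Matrix.diagonal dV) (JW (Fp L) L a₂)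
    (congrW L (Equiv.prodUnique (Fin N) (Fin 1)) dV hdV (lineW L (TW (Fp L) a₂)) (complexConj_lineW L (TW (Fp L) a₂))
            (realDiagonal_lineW L (TW (Fp L) a₂)) (diagonal_lineW L (TW (Fp L) a₂) (JW_eq (Fp L) L a₂))
            (undoubledSplittings L (Equiv.prodUnique (Fin N) (Fin 1)) dV hdV hdV0 (lineW L (TW (Fp L) a₂))
              (complexConj_lineW L (TW (Fp L) a₂)) (lineW_ne_zero L (TW (Fp L) a₂) (isUnit_det_TW (Fp L) a₂)) θ
              (borelPlaceMeasure L)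
              (cmFinLocalFamily L (Equiv.prodUnique (Fin N) (Fin 1)) dV hdV hdV0 (lineW L (TW (Fp L) a₂))
                (complexConj_lineW L (TW (Fp L) a₂)) (lineW_ne_zero L (TW (Fp L) a₂) (isUnit_det_TW (Fp L) a₂)) θ hθs
                (borelPlaceMeasure L)))
            (isSymm_TW (Fp L) a₂) (JW_eq (Fp L) L a₂))
  -- Flath gluing of the local equivalences `M_{x_v}`
  obtain ⟨E, hE⟩ := IsRestrictedTensorProductRep.exists_equiv_of_forall_equiv h₁ h₂
    (fun v => (Literature.RepresentationTheory.MoeglinVignerasWaldspurger1987.lineTransportOp L v (IsCMField.complexConj L) N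
          (conj_lineDelta (complexConj_imagUnit L) a₁) (lineDelta_ne_zero (imagUnit_ne_zero L) a₁)
          (lineDelta_mul_self (imagUnit_mul_self L) a₁) (conj_lineDelta (complexConj_imagUnit L) a₂)
          (lineDelta_ne_zero (imagUnit_ne_zero L) a₂) (lineDelta_mul_self (imagUnit_mul_self L) a₂) (x v)
          (realDiagonal L dV hdV) (realDiagonal_isSymm L dV hdV) (isUnit_det_realDiagonal L dV hdV hdV0) (hx v)))
    (fun v g Φ => lineTransportOp_omegaLoc_localLineInl L dV hdV hdV0 v hN θ hθs a₁ a₂ (x v) (hx v) g Φ) (hP3 x hx hint)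
  -- conjugate by the Kronecker re-indexing `R` and descend by (T0′)
  refine (exists_omegaAtLine_equiv_rhoVAtLine_of_twoLines_V (Fp L) L (IsCMField.complexConj L) N
    (Equiv.prodUnique (Fin N) (Fin 1)) (Matrix.diagonal dV) (complexConj_imagUnit L) (imagUnit_ne_zero L)
    (imagUnit_mul_self L) (realDiagonal_isSymm L dV hdV) (isUnit_det_realDiagonal L dV hdV hdV0) (realDiagonal_map L dV hdV).symm
    (fun b => isCompatible_chiSplittingLine L (Equiv.prodUnique (Fin N) (Fin 1)) dV hdV hdV0 θ hθu hθs (TW (Fp L) b)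
      (isSymm_TW (Fp L) b) (isUnit_det_TW (Fp L) b) (JW (Fp L) L b) (JW_eq (Fp L) L b)) a₁ a₂ χ
    ((finSBReindex (Fp L) (Equiv.prodUnique (Fin N) (Fin 1))).trans
      (E.trans (finSBReindex (Fp L) (Equiv.prodUnique (Fin N) (Fin 1))).symm)) (fun k f => ?_)).imp
    fun Ψ h => fun k y => (h.2 k y).symm
  simp only [LinearEquiv.trans_apply, finPairRepV_chiSplittingLine_apply, LinearEquiv.apply_symm_apply]
  rw [FinLocalSplittings.Omega_finPairEmb_inl, FinLocalSplittings.Omega_finPairEmb_inl]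
  exact congrArg (finSBReindex (Fp L) (Equiv.prodUnique (Fin N) (Fin 1))).symm
    (LinearMap.congr_fun (hE (finAdelicEquiv (Fp L) L (IsCMField.complexConj L) N (Matrix.diagonal dV) k))
      (finSBReindex (Fp L) (Equiv.prodUnique (Fin N) (Fin 1)) f)).symm

end Literature.NumberTheory.Automorphic.Liu2021.Def411WeilCarriers

end
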